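import Literature.NumberTheory.GaloisCohomology.KummerClassLocalPower
import Literature.NumberTheory.GaloisCohomology.LocalInvariantMapEvaluation
import Literature.NumberTheory.GaloisRepresentations.LocalUnitGroupFiniteIndexOpen
import Literature.NumberTheory.GaloisRepresentations.HeckeCharacterWeakApproximation
import Literature.AnabelianGeometry.AbsoluteAnabelian.NumberFieldCyclotomeRigidityProofs
import HarnessLib

/-!
# Kummer classes: local surjectivity and simultaneous global representatives
# (`H¹(K, μₙ) → ∏_{v ∈ S} H¹(K_v, μₙ)` is onto for a finite set `S` of finite places)

Let `F` be a field of characteristic `0`, `n ≥ 1`, `κₙ = δ₀ : Fˣ → H¹(Γ_F, μₙ)` the Kummer connecting map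
of the tree (`isSES_kummer`, `baseUnitsInvariant`).  By Hilbert 90 (`subsingleton_galoisCohomology_units_one_holds`)
and the exactness of the Kummer sequence at `H¹(μₙ)` (`IsSES.exists_δ₀_eq_of_map_one_eq_zero`), **every
class of `H¹(Γ_F, μₙ)` is `κₙ(x)` for some `x ∈ Fˣ`** (`exists_δ₀_baseUnitsInvariant_eq`; the invariants of
`F̄ˣ` are `Fˣ`, `InfiniteGalois.mem_range_algebraMap_iff_fixed`).

For a number field `K` and a finite place `v`, the localisation `loc_v : H¹(Γ_K, μₙ) → H¹(Γ_{K_v}, μₙ(K̄)|)`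
(Poitou–Tate dialect, coefficients `(mu K n).toLocal (Sum.inr v)`) becomes, along `μₙ(K̄)| ≅ μₙ(K̄_v)`
(`muLocalIso`, `cohomologyMap_muLocalIso_localization`), the restriction `Res_{K_v/K}`, and
`Res κₙ(b) = κₙ(b_{K_v})` (`resMu_δ₀_baseUnitsInvariant`).  Since `κₙ` on `K_vˣ` kills the OPEN subgroup
`(K_vˣ)ⁿ` (`δ₀_baseUnitsInvariant_pow_eq_zero`, `isOpen_range_powMonoidHom_units`) and `K` is dense in
`∏_{v ∈ S} K_v × K_∞` (weak approximation, `denseRange_algebraMap_pi_prod`):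

**Theorem** (`exists_forall_localization_δ₀_eq`).  For a finite set `S` of finite places and local classes
`t_v ∈ H¹(Γ_{K_v}, μₙ(K̄)|)` (`v ∈ S`) there is `b ∈ Kˣ`, positive at every real place, with
`loc_v κₙ(b) = t_v` for all `v ∈ S`.

This is the «Kummer half» of the `μₙ`-case of Poitou–Tate's `Ker γ¹ ⊆ Im β¹` (Milne *ADT* I Thm. 4.10(b)):
it writes arbitrary local classes as localisations of ONE global Kummer class, so that the class-field half
(`IdeleClassFieldCharacterSeparation.lean`) applies to the idèle of `b`-ratios.  Proof file: theorems only
(no definition, no named fact, no instance; D-0026).  HONEST FRAMING: textbook Kummer theory and weak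
approximation; proves no case of BSD (cell bsd-schneider-ideate, crux `AnticycControlAdditiveK`, FINDING
door-c6 g6 §4 node N3).
-- TODO(general form): prescribed components at the real places as well (sign classes, `n` even).

## References

* J.-P. Serre, *Corps locaux* / *Local Fields* (1979), X §3 (Kummer theory, Hilbert 90). [SerreLocalFields1979]
* J. W. S. Cassels, A. Fröhlich (eds.), *Algebraic Number Theory* (1967), Ch. II §6 (weak approximation). [CasselsFrohlichANT1967]
* J. S. Milne, *Arithmetic Duality Theorems*, 2nd ed. (2006), I Thm. 4.10(b). [MilneADT2006]
-/

noncomputable section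

open CategoryTheory Function NumberField IsDedekindDomain Field ValuativeRel
open scoped NumberField Topology

universe u

namespace Literature.NumberTheory.GaloisCohomology

open _root_.ContinuousCohomology
open Literature.NumberTheory.GaloisRepresentations
open Literature.NumberTheory.GaloisRepresentations.DiscreteGaloisModule
open Literature.AnabelianGeometry.AbsoluteAnabelian
open Literature.AnabelianGeometry.AbsoluteAnabelian.Prop121vii

/-! ### §1. Every class of `H¹(Γ_F, μₙ)` is a Kummer class (Hilbert 90) -/

section Field

variable (F : Type u) [Field F] [CharZero F] {n : ℕ} [NeZero n]

/-- **Invariants of `F̄ˣ` are the base field**: every `Γ_F`-invariant of the units module is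
`baseUnitsInvariant F x` for some `x ∈ Fˣ` (infinite Galois theory, `InfiniteGalois.mem_range_algebraMap_iff_fixed`).
[cite: SerreLocalFields1979, X §3] -/
theorem exists_baseUnitsInvariant_eq (u : (units F).toTopRep.ρ.invariants) :
    ∃ (x : F) (hx : x ≠ 0), baseUnitsInvariant F x hx = u := by
  have hfix : ∀ σ : absoluteGaloisGroup F,
      σ • ((unitsVal F (u : UnitsCarrier F) : (AlgebraicClosure F)ˣ) : AlgebraicClosure F) =
        ((unitsVal F (u : UnitsCarrier F) : (AlgebraicClosure F)ˣ) : AlgebraicClosure F) := by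
    intro σ
    have h := u.2 σ
    have h' : unitsVal F ((units F).toTopRep.ρ σ (u : UnitsCarrier F)) = unitsVal F (u : UnitsCarrier F) :=
      congrArg (unitsVal F) h
    rw [ContinuousRep.toTopRep_ρ_apply, unitsVal_apply] at h'
    rw [← Units.coe_smul, h']
  obtain ⟨x, hx⟩ := nf_mem_range_algebraMap_of_forall_smul_eq (F := F) _ hfix
  have hx0 : x ≠ 0 := by
    intro h
    apply (unitsVal F (u : UnitsCarrier F)).ne_zero
    rw [← hx, h, map_zero]
  refine ⟨x, hx0, Subtype.ext (unitsVal_injective F (Units.ext ?_))⟩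
  rw [coe_unitsVal_baseUnitsInvariant, hx]

/-- **Every class of `H¹(Γ_F, μₙ)` is a Kummer class `κₙ(x) = δ₀(x)`, `x ∈ Fˣ`** (Hilbert 90
`H¹(Γ_F, F̄ˣ) = 0` + exactness of the Kummer sequence at `H¹(μₙ)`; `Fˣ/Fˣⁿ ≅ H¹(Γ_F, μₙ)`).
[cite: SerreLocalFields1979, X §3] -/
theorem exists_δ₀_baseUnitsInvariant_eq (c : continuousCohomology 1 (mu F n).toTopRep) :
    ∃ (x : F) (hx : x ≠ 0), (isSES_kummer F n (NeZero.pos n)).δ₀ (baseUnitsInvariant F x hx) = c := by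
  haveI : Subsingleton (continuousCohomology 1 (units F).toTopRep) :=
    subsingleton_galoisCohomology_units_one_holds F
  obtain ⟨u, hu⟩ := (isSES_kummer F n (NeZero.pos n)).exists_δ₀_eq_of_map_one_eq_zero c (Subsingleton.elim _ _)
  obtain ⟨x, hx, rfl⟩ := exists_baseUnitsInvariant_eq F u
  exact ⟨x, hx, hu⟩

omit [CharZero F] in
/-- `baseUnitsInvariant` only depends on the element. [folklore] -/
private theorem baseUnitsInvariant_congr {x y : F} (hx : x ≠ 0) (hy : y ≠ 0) (h : x = y) :
    baseUnitsInvariant F x hx = baseUnitsInvariant F y hy := by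
  subst h; rfl

omit [CharZero F] in
/-- **`κₙ(x · tⁿ) = κₙ(x)`**: the Kummer class only depends on `x` modulo `n`-th powers.
[cite: SerreLocalFields1979, X §3] -/
theorem δ₀_baseUnitsInvariant_mul_pow (x t : F) (hx : x ≠ 0) (ht : t ≠ 0) :
    (isSES_kummer F n (NeZero.pos n)).δ₀ (baseUnitsInvariant F (x * t ^ n) (mul_ne_zero hx (pow_ne_zero n ht))) =
      (isSES_kummer F n (NeZero.pos n)).δ₀ (baseUnitsInvariant F x hx) := by
  rw [baseUnitsInvariant_mul F x (t ^ n) hx (pow_ne_zero n ht), map_add, δ₀_baseUnitsInvariant_pow_eq_zero F t ht,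
    add_zero]

end Field

/-! ### §2. Number fields: local classes are localisations of global Kummer classes -/

section NumberField

variable {K : Type u} [Field K] [NumberField K] {n : ℕ} [NeZero n]

/-- **Local Kummer surjectivity in the Poitou–Tate dialect**: every class of `H¹(Γ_{K_v}, μₙ(K̄)|)` is,
along `μₙ(K̄)| ≅ μₙ(K̄_v)`, the Kummer class of some `x ∈ K_vˣ`. [cite: SerreLocalFields1979, X §3] -/
theorem exists_cohomologyMap_muLocalIso_eq_δ₀ (v : HeightOneSpectrum (𝓞 K))
    (t : galoisCohomology ((mu K n).toLocal (Sum.inr v)) 1) :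
    ∃ (x : v.adicCompletion K) (hx : x ≠ 0),
      (cohomologyMap (muLocalIso v n).hom 1).hom t =
        (isSES_kummer (v.adicCompletion K) n (NeZero.pos n)).δ₀ (baseUnitsInvariant (v.adicCompletion K) x hx) := by
  haveI : CharZero (v.adicCompletion K) := charZero_adicCompletion v
  obtain ⟨x, hx, h⟩ := exists_δ₀_baseUnitsInvariant_eq (v.adicCompletion K) ((cohomologyMap (muLocalIso v n).hom 1).hom t)
  exact ⟨x, hx, h.symm⟩

/-- **`loc_v κₙ(b) = t` as soon as `b ≡ x (mod (K_vˣ)ⁿ)` for a local representative `x` of `t`.**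
[cite: SerreLocalFields1979, X §3] -/
theorem localization_δ₀_baseUnitsInvariant_eq_of_eq_mul_pow (v : HeightOneSpectrum (𝓞 K))
    (t : galoisCohomology ((mu K n).toLocal (Sum.inr v)) 1) {x : v.adicCompletion K} (hx : x ≠ 0)
    (ht : (cohomologyMap (muLocalIso v n).hom 1).hom t =
      (isSES_kummer (v.adicCompletion K) n (NeZero.pos n)).δ₀ (baseUnitsInvariant (v.adicCompletion K) x hx))
    (b : K) (hb : b ≠ 0) {s : v.adicCompletion K} (hs : s ≠ 0)
    (hbx : algebraMap K (v.adicCompletion K) b = x * s ^ n) :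
    galoisCohomology.localization (mu K n) (Sum.inr v) 1
      ((isSES_kummer K n (NeZero.pos n)).δ₀ (baseUnitsInvariant K b hb)) = t := by
  have hinj : Injective (fun c => (cohomologyMap (muLocalIso v n).hom 1).hom c) :=
    (continuousCohomologyEquivOfIso (muLocalIso v n) 1).injective
  apply hinj
  have hb' : algebraMap K (v.adicCompletion K) b ≠ 0 := (map_ne_zero_iff _ (algebraMap K _).injective).2 hb
  change (cohomologyMap (muLocalIso v n).hom 1).hom (galoisCohomology.localization (mu K n) (Sum.inr v) 1 _) =
    (cohomologyMap (muLocalIso v n).hom 1).hom t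
  rw [cohomologyMap_muLocalIso_localization, resMu_δ₀_baseUnitsInvariant K (v.adicCompletion K) b hb hb', ht,
    baseUnitsInvariant_congr (v.adicCompletion K) hb' (mul_ne_zero hx (pow_ne_zero n hs)) hbx,
    δ₀_baseUnitsInvariant_mul_pow (v.adicCompletion K) x s hx hs]

/-- **`H¹(K, μₙ) → ∏_{v ∈ S} H¹(K_v, μₙ)` is onto, with a representative positive at the real places.**
For a finite set `S` of finite places of the number field `K` and local classes
`t_v ∈ H¹(Γ_{K_v}, μₙ(K̄)|)` (`v ∈ S`; values at `v ∉ S` ignored) there is `b ∈ Kˣ`, positive at every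
real place, whose global Kummer class localises to `t_v` at every `v ∈ S`: local Kummer surjectivity
(`exists_cohomologyMap_muLocalIso_eq_δ₀`), openness of `(K_vˣ)ⁿ` (`isOpen_range_powMonoidHom_units`) and
weak approximation (`denseRange_algebraMap_pi_prod`). [cite: CasselsFrohlichANT1967, Ch. II §6]
[cite: SerreLocalFields1979, X §3] -/
theorem exists_forall_localization_δ₀_eq (S : Finset (HeightOneSpectrum (𝓞 K)))
    (t : ∀ v : HeightOneSpectrum (𝓞 K), galoisCohomology ((mu K n).toLocal (Sum.inr v)) 1) :
    ∃ (b : K) (hb : b ≠ 0),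
      (∀ (w : InfinitePlace K) (hw : w.IsReal),
        0 < InfinitePlace.Completion.extensionEmbeddingOfIsReal hw (algebraMap K w.Completion b)) ∧
      ∀ v ∈ S, galoisCohomology.localization (mu K n) (Sum.inr v) 1
        ((isSES_kummer K n (NeZero.pos n)).δ₀ (baseUnitsInvariant K b hb)) = t v := by
  classical
  -- local representatives
  have hloc : ∀ v : HeightOneSpectrum (𝓞 K), ∃ (x : v.adicCompletion K) (hx : x ≠ 0),
      (cohomologyMap (muLocalIso v n).hom 1).hom (t v) =
        (isSES_kummer (v.adicCompletion K) n (NeZero.pos n)).δ₀ (baseUnitsInvariant (v.adicCompletion K) x hx) :=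
    fun v => exists_cohomologyMap_muLocalIso_eq_δ₀ v (t v)
  choose x hx0 hx using hloc
  -- `Units.val : K_vˣ → K_v` is an open map
  have hvalopen : ∀ v : HeightOneSpectrum (𝓞 K),
      IsOpenMap (Units.val : (v.adicCompletion K)ˣ → v.adicCompletion K) := by
    intro v
    have hrange : Set.range (Units.val : (v.adicCompletion K)ˣ → v.adicCompletion K) = {0}ᶜ := by
      ext y
      simp only [Set.mem_range, Set.mem_compl_iff, Set.mem_singleton_iff]
      exact ⟨fun ⟨u, hu⟩ => hu ▸ u.ne_zero, fun hy => ⟨Units.mk0 y hy, rfl⟩⟩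
    exact (⟨Units.isEmbedding_val₀, by rw [hrange]; exact isOpen_compl_singleton⟩ :
      Topology.IsOpenEmbedding (Units.val : (v.adicCompletion K)ˣ → v.adicCompletion K)).isOpenMap
  -- the open cosets `x_v · (K_vˣ)ⁿ`
  set C : ∀ v : HeightOneSpectrum (𝓞 K), Set (v.adicCompletion K)ˣ := fun v =>
    (fun y => (Units.mk0 (x v) (hx0 v))⁻¹ * y) ⁻¹'
      ((powMonoidHom n : (v.adicCompletion K)ˣ →* (v.adicCompletion K)ˣ).range : Set (v.adicCompletion K)ˣ)
    with hCdef
  have hCopen : ∀ v, IsOpen (C v) := fun v => by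
    haveI : CharZero (v.adicCompletion K) := charZero_adicCompletion v
    exact (isOpen_range_powMonoidHom_units (v.adicCompletion K) (Nat.cast_ne_zero.mpr (NeZero.ne n))).preimage
      (continuous_const_mul _)
  set O : Set ((∀ v : S, v.1.adicCompletion K) × InfiniteAdeleRing K) :=
    {p | (∀ v : S, p.1 v ∈ Units.val '' C v.1) ∧
      ∀ (w : InfinitePlace K) (hw : w.IsReal),
        0 < InfinitePlace.Completion.extensionEmbeddingOfIsReal hw (p.2 w)} with hOdef
  have hOopen : IsOpen O := by
    have h1 : IsOpen {p : (∀ v : S, v.1.adicCompletion K) × InfiniteAdeleRing K |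
        ∀ v : S, p.1 v ∈ Units.val '' C v.1} := by
      rw [Set.setOf_forall]
      exact isOpen_iInter_of_finite fun v =>
        ((hvalopen v.1) _ (hCopen v.1)).preimage ((continuous_apply v).comp continuous_fst)
    have h2 : IsOpen {p : (∀ v : S, v.1.adicCompletion K) × InfiniteAdeleRing K |
        ∀ (w : InfinitePlace K) (hw : w.IsReal),
          0 < InfinitePlace.Completion.extensionEmbeddingOfIsReal hw (p.2 w)} := by
      rw [Set.setOf_forall]
      refine isOpen_iInter_of_finite fun w => ?_
      by_cases hw : w.IsReal
      · have hc : Continuous fun p : (∀ v : S, v.1.adicCompletion K) × InfiniteAdeleRing K =>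
            InfinitePlace.Completion.extensionEmbeddingOfIsReal hw (p.2 w) :=
          (InfinitePlace.Completion.isometry_extensionEmbeddingOfIsReal hw).continuous.comp
            ((continuous_apply w).comp continuous_snd)
        have : {p : (∀ v : S, v.1.adicCompletion K) × InfiniteAdeleRing K |
            ∀ hw' : w.IsReal, 0 < InfinitePlace.Completion.extensionEmbeddingOfIsReal hw' (p.2 w)} =
            (fun p => InfinitePlace.Completion.extensionEmbeddingOfIsReal hw (p.2 w)) ⁻¹' Set.Ioi 0 := by
          ext p
          simp only [Set.mem_setOf_eq, Set.mem_preimage, Set.mem_Ioi]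
          exact ⟨fun h => h hw, fun h _ => h⟩
        rw [this]
        exact isOpen_Ioi.preimage hc
      · have : {p : (∀ v : S, v.1.adicCompletion K) × InfiniteAdeleRing K |
            ∀ hw' : w.IsReal, 0 < InfinitePlace.Completion.extensionEmbeddingOfIsReal hw' (p.2 w)} = Set.univ :=
          Set.eq_univ_of_forall fun p hw' => absurd hw' hw
        rw [this]
        exact isOpen_univ
    exact h1.inter h2
  have hOne : O.Nonempty := by
    refine ⟨(fun v => x v.1, fun _ => 1), fun v => ⟨Units.mk0 (x v.1) (hx0 v.1), ?_, rfl⟩, fun w hw => ?_⟩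
    · change (Units.mk0 (x v.1) (hx0 v.1))⁻¹ * Units.mk0 (x v.1) (hx0 v.1) ∈
        (((powMonoidHom n : (v.1.adicCompletion K)ˣ →* (v.1.adicCompletion K)ˣ).range : Subgroup _) :
          Set (v.1.adicCompletion K)ˣ)
      rw [inv_mul_cancel]
      exact Subgroup.one_mem _
    · change 0 < InfinitePlace.Completion.extensionEmbeddingOfIsReal hw 1
      rw [map_one]; exact one_pos
  obtain ⟨b, hb⟩ := (denseRange_algebraMap_pi_prod (K := K) S).exists_mem_open hOopen hOne
  obtain ⟨hbfin, hbinf⟩ := hb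
  -- `S = ∅`: take `b = 1`
  rcases S.eq_empty_or_nonempty with hS | ⟨v₀, hv₀⟩
  · refine ⟨(1 : K), one_ne_zero, fun w hw => ?_, fun v hv => ?_⟩
    · rw [map_one, map_one]; exact one_pos
    · rw [hS] at hv; exact absurd hv (Finset.notMem_empty v)
  -- `S ≠ ∅`: `b ≠ 0`
  have hb0 : b ≠ 0 := by
    obtain ⟨u, -, hu⟩ := hbfin ⟨v₀, hv₀⟩
    intro h
    apply u.ne_zero
    rw [hu]
    change algebraMap K (v₀.adicCompletion K) b = 0
    rw [h, map_zero]
  refine ⟨b, hb0, fun w hw => hbinf w hw, fun v hv => ?_⟩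
  obtain ⟨u, huC, hu⟩ := hbfin ⟨v, hv⟩
  obtain ⟨s, hs⟩ := huC
  have hu' : (u : v.adicCompletion K) = algebraMap K (v.adicCompletion K) b := hu
  refine localization_δ₀_baseUnitsInvariant_eq_of_eq_mul_pow v (t v) (hx0 v) (hx v) b hb0 s.ne_zero ?_
  rw [← hu', ← Units.val_mk0 (hx0 v), ← Units.val_pow_eq_pow_val, ← Units.val_mul, ← powMonoidHom_apply, hs,
    mul_inv_cancel_left]

end NumberField

end Literature.NumberTheory.GaloisCohomology

end
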